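import Literature.NumberTheory.GaloisCohomology.Howard2004.SelmerTriples
import Literature.NumberTheory.EllipticCurves.SelmerGaloisActionPlaces
import HarnessLib

/-!
# Howard 2004, §1.3: the canonical `ConjugationDatum` of an imaginary quadratic field

Tranche 3 of (W9)-A (`Howard2004/SelmerTriples.lean`): an INHABITANT of `ConjugationDatum K`
(«Let `τ ∈ G_ℚ` be a fixed complex conjugation … conjugation by `τ` induces an isomorphism
`H^i(K_v̄, T) ≅ H^i(K_v, Tw(T))` where `v̄ = v^τ`», arXiv:1202.6340 p. 5 L8, p. 7 L44–48) from a
non-trivial involution `σ` of `K`, an involutive lift `τ` of `σ` to `K̄`, and — at every finite place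
`v` — the tree's adapted lifts (`liftAutPlace`, `galAdicCompletionEquiv`, `ringEquivLift` of
`EllipticCurves.SelmerGaloisActionPlaces`): the local transport `φ_v : Γ_{K_v} → Γ_{K_{σ v}}` is
conjugation by the chosen lift `Θ_v` of the Galois transport of completions `K_{σ v} ≃+* K_v`, and
the inner correction is `δ_v = τ⁻¹ τ_v ∈ Γ_K` (`τ_v` the lift of `σ` adapted to `Θ_v`).
Everything here is a definition with a body or a proved lemma; no named fact, no `sorry`, no
instance.

## References
* B. Howard, *The Heegner point Kolyvagin system*, Compositio Math. 140 (2004), §1.3.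
  [Howard2004HeegnerKolyvagin]
* J.-P. Serre, *Galois Cohomology* (1997), II.§1.1 (decomposition groups up to conjugacy).
  [SerreGaloisCohomology1997]
-/

set_option autoImplicit false

noncomputable section

open Function NumberField IsDedekindDomain Field
open scoped NumberField Classical

namespace Literature.NumberTheory.GaloisCohomology.Howard2004

open Literature.NumberTheory.GaloisRepresentations Literature.NumberTheory.EllipticCurves
  Literature.NumberTheory.Automorphic

namespace ConjugationDatum

variable {K : Type} [Field K] [NumberField K]

/-- For an involution `σ` (`σ * σ = 1`): `σ • (σ • v) = v`. [folklore] -/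
private theorem smul_smul_eq_self {σ : K ≃ₐ[ℚ] K} (hσ : σ * σ = 1) (v : HeightOneSpectrum (𝓞 K)) :
    σ • (σ • v) = v := by
  rw [smul_smul, hσ, one_smul]

/-- The Galois transport of completions `K_{σ v} ≃+* K_v` (tree `galAdicCompletionEquiv` for
`σ • (σ • v) = v`). [cite: SerreGaloisCohomology1997, II.§1.1] -/
def theta {σ : K ≃ₐ[ℚ] K} (hσ : σ * σ = 1) (v : HeightOneSpectrum (𝓞 K)) :
    (σ • v).adicCompletion K ≃+* v.adicCompletion K :=
  galAdicCompletionEquiv (L := K) σ (smul_smul_eq_self hσ v)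

/-- Its chosen lift to the algebraic closures lifts it. [cite: SerreGaloisCohomology1997, II.§1.1] -/
theorem isLift_theta {σ : K ≃ₐ[ℚ] K} (hσ : σ * σ = 1) (v : HeightOneSpectrum (𝓞 K)) :
    IsLiftOfRingEquiv (theta hσ v) (ringEquivLift (theta hσ v)) :=
  isLiftOfRingEquiv_ringEquivLift _

/-- The lift `τ_v` of `σ` adapted to the place datum (tree `liftAutPlace`). [cite: SerreGaloisCohomology1997, II.§1.1] -/
def tauAt {σ : K ≃ₐ[ℚ] K} (hσ : σ * σ = 1) (v : HeightOneSpectrum (𝓞 K)) :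
    AlgebraicClosure K ≃+* AlgebraicClosure K :=
  liftAutPlace σ (smul_smul_eq_self hσ v)

/-- `τ_v` lifts `σ`. [cite: SerreGaloisCohomology1997, II.§1.1] -/
theorem isLiftOfAut_tauAt {σ : K ≃ₐ[ℚ] K} (hσ : σ * σ = 1) (v : HeightOneSpectrum (𝓞 K)) :
    IsLiftOfAut σ (tauAt hσ v) :=
  isLiftOfAut_liftAutPlace σ _

/-- `τ_v` is adapted to the chosen lift of the transport. [cite: SerreGaloisCohomology1997, II.§1.1] -/
theorem liftsCommute_tauAt {σ : K ≃ₐ[ℚ] K} (hσ : σ * σ = 1) (v : HeightOneSpectrum (𝓞 K)) :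
    LiftsCommute (E := (σ • v).adicCompletion K) (E' := v.adicCompletion K) (tauAt hσ v)
      (ringEquivLift (theta hσ v)) :=
  liftsCommute_liftAutPlace σ _

/-- **The inner correction `δ_v = τ⁻¹ τ_v ∈ Γ_K`** (two lifts of `σ` differ by an element of `Γ_K`).
[cite: SerreGaloisCohomology1997, II.§1.1] -/
def delta {σ : K ≃ₐ[ℚ] K} (hσ : σ * σ = 1) {τ : AlgebraicClosure K ≃+* AlgebraicClosure K}
    (hτ : IsLiftOfAut σ τ) (v : HeightOneSpectrum (𝓞 K)) : absoluteGaloisGroup K :=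
  show AlgebraicClosure K ≃ₐ[K] AlgebraicClosure K from
  { (tauAt hσ v).trans τ.symm with
    commutes' := fun x => by
      change τ.symm (tauAt hσ v (algebraMap K _ x)) = algebraMap K _ x
      rw [isLiftOfAut_tauAt hσ v x, hτ.symm_apply, AlgEquiv.symm_apply_apply] }

/-- Unfolding `delta`: `δ_v x = τ⁻¹ (τ_v x)`. [cite: SerreGaloisCohomology1997, II.§1.1] -/
theorem delta_apply {σ : K ≃ₐ[ℚ] K} (hσ : σ * σ = 1) {τ : AlgebraicClosure K ≃+* AlgebraicClosure K}
    (hτ : IsLiftOfAut σ τ) (v : HeightOneSpectrum (𝓞 K)) (x : AlgebraicClosure K) :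
    (show AlgebraicClosure K ≃ₐ[K] AlgebraicClosure K from delta hσ hτ v) x = τ.symm (tauAt hσ v x) :=
  rfl

/-- The local transport `φ_v : Γ_{K_v} → Γ_{K_{σ v}}`, conjugation by the chosen lift of `K_{σ v} ≃ K_v`.
[cite: Howard2004HeegnerKolyvagin, §1.3 (arXiv p. 7, L44–48)] -/
def phi {σ : K ≃ₐ[ℚ] K} (hσ : σ * σ = 1) (v : HeightOneSpectrum (𝓞 K)) :
    absoluteGaloisGroup (v.adicCompletion K) →ₜ* absoluteGaloisGroup ((σ • v).adicCompletion K) :=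
  (isLift_theta hσ v).conjGalCMH

/-- `φ_v` is bijective (conjugation by `Θ⁻¹` is its inverse). [cite: SerreGaloisCohomology1997, II.§1.1] -/
theorem phi_bijective {σ : K ≃ₐ[ℚ] K} (hσ : σ * σ = 1) (v : HeightOneSpectrum (𝓞 K)) :
    Function.Bijective (phi hσ v) := by
  have h1 := (isLift_theta hσ v).conjGalCMH_comp_symm
  have h2 := (isLift_theta hσ v).symm.conjGalCMH_comp_symm
  refine Function.bijective_iff_has_inverse.mpr ⟨(isLift_theta hσ v).symm.conjGalCMH, ?_, ?_⟩
  · intro g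
    exact DFunLike.congr_fun h2 g
  · intro g
    exact DFunLike.congr_fun h1 g

/-- The compatibility: `res_{σv} (φ_v g) = δ_v⁻¹ · (τ⁻¹ (res_v g) τ) · δ_v`.
[cite: Howard2004HeegnerKolyvagin, §1.3 (arXiv p. 7, L44–48)] -/
theorem phi_compat {σ : K ≃ₐ[ℚ] K} (hσ : σ * σ = 1) {τ : AlgebraicClosure K ≃+* AlgebraicClosure K}
    (hτ : IsLiftOfAut σ τ) (v : HeightOneSpectrum (𝓞 K))
    (g : absoluteGaloisGroup (v.adicCompletion K)) :
    absGaloisRestrict K ((σ • v).adicCompletion K) (phi hσ v g) =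
      (delta hσ hτ v)⁻¹ * hτ.conjGalCMH (absGaloisRestrict K (v.adicCompletion K) g) *
        delta hσ hτ v := by
  rw [phi, (liftsCommute_tauAt hσ v).absGaloisRestrict_conjGalCMH (isLiftOfAut_tauAt hσ v)
    (isLift_theta hσ v) g]
  apply AlgEquiv.ext
  intro x
  change (tauAt hσ v).symm
      ((show AlgebraicClosure K ≃ₐ[K] AlgebraicClosure K from
          absGaloisRestrict K (v.adicCompletion K) g) (tauAt hσ v x)) =
    (show AlgebraicClosure K ≃ₐ[K] AlgebraicClosure K from delta hσ hτ v).symm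
      (τ.symm ((show AlgebraicClosure K ≃ₐ[K] AlgebraicClosure K from
          absGaloisRestrict K (v.adicCompletion K) g) (τ (τ.symm (tauAt hσ v x)))))
  rw [RingEquiv.apply_symm_apply, eq_comm, AlgEquiv.symm_apply_eq]
  change _ = τ.symm (tauAt hσ v ((tauAt hσ v).symm _))
  rw [RingEquiv.apply_symm_apply]

/-- **The canonical conjugation datum** of `K` attached to a non-trivial involution `σ` and an
involutive lift `τ` (a complex conjugation of `K̄`), with the tree's adapted local lifts at every
finite place. [cite: Howard2004HeegnerKolyvagin, §1.3 (arXiv p. 5 L8, p. 7 L33–48)] -/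
def ofLifts (σ : K ≃ₐ[ℚ] K) (hσ₁ : σ ≠ 1) (hσ : σ * σ = 1)
    (τ : AlgebraicClosure K ≃+* AlgebraicClosure K) (hτ : IsLiftOfAut σ τ)
    (hτ₂ : Function.Involutive τ) : ConjugationDatum K where
  σ := σ
  σ_ne_one := hσ₁
  τ := τ
  isLift := hτ
  involutive := hτ₂
  φ := phi hσ
  φ_bijective := phi_bijective hσ
  δ := delta hσ hτ
  compat := fun v g => phi_compat hσ hτ v g

/-- Unfolding: the `σ` of `ofLifts`. [cite: Howard2004HeegnerKolyvagin, §1.3 (arXiv p. 7, L33–48)] -/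
@[simp] theorem ofLifts_σ (σ : K ≃ₐ[ℚ] K) (hσ₁ : σ ≠ 1) (hσ : σ * σ = 1)
    (τ : AlgebraicClosure K ≃+* AlgebraicClosure K) (hτ : IsLiftOfAut σ τ)
    (hτ₂ : Function.Involutive τ) : (ofLifts σ hσ₁ hσ τ hτ hτ₂).σ = σ := rfl

/-- Unfolding: the `τ` of `ofLifts`. [cite: Howard2004HeegnerKolyvagin, §1.3 (arXiv p. 7, L33–48)] -/
@[simp] theorem ofLifts_τ (σ : K ≃ₐ[ℚ] K) (hσ₁ : σ ≠ 1) (hσ : σ * σ = 1)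
    (τ : AlgebraicClosure K ≃+* AlgebraicClosure K) (hτ : IsLiftOfAut σ τ)
    (hτ₂ : Function.Involutive τ) : (ofLifts σ hσ₁ hσ τ hτ hτ₂).τ = τ := rfl

end ConjugationDatum

end Literature.NumberTheory.GaloisCohomology.Howard2004
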